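import Mathlib
import HarnessLib
import Summits.HubbardSuperconductivity.HubbardSuperconductivity.Theorems.KLProgrammeKLRegimeTwoVolumeSourceSmoothDefs
import Summits.HubbardSuperconductivity.HubbardSuperconductivity.Theorems.KLProgrammeKLRegimeTwoVolumeSourceWindowKernel
import Summits.HubbardSuperconductivity.HubbardSuperconductivity.Theorems.KLProgrammeKLRegimeTwoVolumeTowerBaseSrcBlockRows

/-!
# Route `KLProgramme` — crux K3, VL child (stmt-HubbardSuperconductivity-20440), keying option «(VL)-SRC-WINDOW»: THE SMOOTHING KERNEL HAS `M`-UNIFORM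
# `ℓ¹` ROWS AND COLUMNS (seat hubbard-kl-k3c4-p1 g16, filed by g17 under the pen's (R235) «KEY = WINDOW»)

`‖W_c(τ, ·)‖_{ℓ¹} ≤ √(2+π)·√(1+c₁²)` (`c₁` = a Lipschitz constant of `χ` on `[−2,2]`, existential: `exists_srcWindowFn_lipschitz`) for the time-smoothing kernel `W_c(τ,τ′) = (1/2M)·Σ_j w_j e^{−i s_c π(2n_j+1)(τ−τ′)/(2M)}` of `…TwoVolumeSourceSmoothDefs` (smooth window
`χ((2n_j+1)/M)`, first differences `≤ 2c₁/M`): the row is `(1/2M)·Σ_x ‖Σ_k χ_k(x) h(k)‖` over `(ℤ/2M)¹` with `h(k) = w_{k}` (re-indexing `τ′ ↦ ∓(τ−τ′) mod 2M`, the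
`j`-independent phase dropped under the norm, `torusChar_natCast_one`), and `…TwoVolumeSourceWindowKernel.sum_norm_charSum_one_le_of_bounds` with
`Ns = Nd = 2M`, `A = 1`, `D = c₁` gives `(1/2M)·√(2+π)·√(2M·(2M + 2M c₁²)) = √(2+π)·√(1+c₁²)` (`sum_norm_srcSmoothKernel_row_le'`; `exists_srcSmoothKernel_l1_bound`
packages the existential `M`-uniform constant `C_W = √(2+π)·√(1+c₁²)` for rows and columns).

* `exists_srcWindowFn_lipschitz`, `abs_srcWindowWt_sub_le`, `norm_srcSmoothKernel_eq_charSum`, **`sum_norm_srcSmoothKernel_row_le`**,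
  **`sum_norm_srcSmoothKernel_col_le`**.

Proofs only.  Pure finite Fourier analysis; nothing about the Hubbard model is asserted.  [cite: BenfattoGiulianiMastropietro2006, Lemma 2.2 and footnote 1]
-/

noncomputable section

namespace Summit.HubbardSuperconductivity.HubbardSuperconductivity.Theorems.TwoVolumeSource

set_option linter.dupNamespace false -- summit = problem name (single-conjunct summit), D-0017

open Finset Complex Literature.MathematicalPhysics.QuantumLattice Literature.Probability.LatticeModels
open scoped Real

/-! ## §1 The window's first differences -/

/-- **`χ` is Lipschitz on `[−2, 2]`** (continuous derivative on a compact interval, mean value theorem). [folklore] -/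
theorem exists_srcWindowFn_lipschitz :
    ∃ c₁ : ℝ, 0 ≤ c₁ ∧ ∀ x y : ℝ, x ∈ Set.Icc (-2 : ℝ) 2 → y ∈ Set.Icc (-2 : ℝ) 2 → |srcWindowFn y - srcWindowFn x| ≤ c₁ * |y - x| := by
  have hd : Continuous (deriv srcWindowFn) := (contDiff_srcWindowFn (n := 1)).continuous_deriv le_rfl
  obtain ⟨C, hC⟩ := (isCompact_Icc : IsCompact (Set.Icc (-2 : ℝ) 2)).exists_bound_of_continuousOn hd.continuousOn
  refine ⟨max C 0, le_max_right _ _, fun x y hx hy => ?_⟩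
  have hdiff : ∀ z ∈ Set.Icc (-2 : ℝ) 2, DifferentiableAt ℝ srcWindowFn z := fun z _ =>
    ((contDiff_srcWindowFn (n := 1)).differentiable (by norm_num)) z
  have hbound : ∀ z ∈ Set.Icc (-2 : ℝ) 2, ‖deriv srcWindowFn z‖ ≤ max C 0 := fun z hz => (hC z hz).trans (le_max_left _ _)
  have := (convex_Icc (-2 : ℝ) 2).norm_image_sub_le_of_norm_deriv_le hdiff hbound hx hy
  simpa only [Real.norm_eq_abs] using this

/-- The window arguments `x_j = (2n_j+1)/M` lie in `[−2, 2]`. [folklore] -/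
theorem srcWindowArg_mem_Icc {M : ℕ} (hM : 0 < M) (j : MatsubaraIdx M) : (2 * (matsubaraInt M j : ℝ) + 1) / M ∈ Set.Icc (-2 : ℝ) 2 := by
  have hMr : (0 : ℝ) < M := by exact_mod_cast hM
  have hj := j.2
  have hn : (matsubaraInt M j : ℝ) = ((j : ℕ) : ℝ) - M := by rw [matsubaraInt]; push_cast; ring
  have hj' : ((j : ℕ) : ℝ) ≤ 2 * M - 1 := by
    have : (j : ℕ) + 1 ≤ 2 * M := hj
    have : ((j : ℕ) : ℝ) + 1 ≤ 2 * M := by exact_mod_cast this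
    linarith
  have hj0 : (0 : ℝ) ≤ (j : ℕ) := Nat.cast_nonneg _
  rw [Set.mem_Icc, le_div_iff₀ hMr, div_le_iff₀ hMr, hn]
  constructor <;> nlinarith

/-- **`|w_{j′} − w_j| ≤ c₁·|x_{j′} − x_j|`**. [folklore] -/
theorem abs_srcWindowWt_sub_le {M : ℕ} (hM : 0 < M) {c₁ : ℝ}
    (hc : ∀ x y : ℝ, x ∈ Set.Icc (-2 : ℝ) 2 → y ∈ Set.Icc (-2 : ℝ) 2 → |srcWindowFn y - srcWindowFn x| ≤ c₁ * |y - x|) (j j' : MatsubaraIdx M) :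
    |srcWindowWt M j' - srcWindowWt M j| ≤ c₁ * |(2 * (matsubaraInt M j' : ℝ) + 1) / M - (2 * (matsubaraInt M j : ℝ) + 1) / M| :=
  hc _ _ (srcWindowArg_mem_Icc hM j) (srcWindowArg_mem_Icc hM j')

/-! ## §2 The kernel as a one-dimensional character sum, and its `ℓ¹` rows / columns -/

section Kernel

variable {M : ℕ} [NeZero M] [NeZero (2 * M)]

omit [NeZero M] in
/-- The window as a symbol on `(ℤ/2M)¹`. -/
theorem srcWindowSymbol_norm_le (k : TorusSite 1 (2 * M)) :
    ‖(((srcWindowWt M ⟨(k 0).val, ZMod.val_lt (k 0)⟩ : ℝ)) : ℂ)‖ ≤ 1 := by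
  rw [Complex.norm_real, Real.norm_eq_abs, abs_of_nonneg (srcWindowWt_mem_Icc M _).1]
  exact (srcWindowWt_mem_Icc M _).2

omit [NeZero M] [NeZero (2 * M)] in
/-- `matsubaraInt` as a real number: `n_i = i − M`. [folklore] -/
theorem matsubaraInt_cast_real (i : MatsubaraIdx M) : (matsubaraInt M i : ℝ) = ((i : ℕ) : ℝ) - M := by
  rw [matsubaraInt]; push_cast; ring

/-- The first difference of the window symbol along the unit step is `≤ 2c₁/M = c₁·(4/(2M))` (consecutive indices: the arguments differ by `2/M`; the wrapped pair
`j = 2M−1 → 0` sits at the band edge where the window vanishes). -/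
theorem norm_fwdDiff_srcWindowSymbol_le {c₁ : ℝ} (hc₀ : 0 ≤ c₁)
    (hc : ∀ x y : ℝ, x ∈ Set.Icc (-2 : ℝ) 2 → y ∈ Set.Icc (-2 : ℝ) 2 → |srcWindowFn y - srcWindowFn x| ≤ c₁ * |y - x|) (k : TorusSite 1 (2 * M)) :
    ‖fwdDiff (fun _ : Fin 1 => (1 : ZMod (2 * M))) (fun k : TorusSite 1 (2 * M) => (((srcWindowWt M ⟨(k 0).val, ZMod.val_lt (k 0)⟩ : ℝ)) : ℂ)) k‖ ≤
      c₁ * (4 / ((2 * M : ℕ) : ℝ)) := by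
  have hM : 0 < M := Nat.pos_of_ne_zero (NeZero.ne M)
  have hMr : (0 : ℝ) < M := by exact_mod_cast hM
  rw [fwdDiff, ← Complex.ofReal_sub, Complex.norm_real, Real.norm_eq_abs]
  have hval : ((k + fun _ : Fin 1 => (1 : ZMod (2 * M))) 0).val = ((k 0).val + 1) % (2 * M) := by
    rw [Pi.add_apply, ZMod.val_add, ZMod.val_one_eq_one_mod, Nat.mod_eq_of_lt (show 1 < 2 * M by omega)]
  by_cases hwrap : (k 0).val + 1 = 2 * M
  · -- wrap: both indices at the band edge, both weights vanish
    have h0 : ((k + fun _ : Fin 1 => (1 : ZMod (2 * M))) 0).val = 0 := by rw [hval, hwrap, Nat.mod_self]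
    have hw1 : srcWindowWt M ⟨((k + fun _ : Fin 1 => (1 : ZMod (2 * M))) 0).val, ZMod.val_lt _⟩ = 0 := by
      refine srcWindowWt_eq_zero hM ?_
      have h1M : (1 : ℝ) ≤ M := by exact_mod_cast hM
      rw [matsubaraInt_cast_real]; dsimp only; rw [h0]; push_cast
      rw [show (2 : ℝ) * (0 - M) + 1 = -(2 * M - 1) by ring, abs_neg, abs_of_nonneg (by linarith)]
      linarith
    have hw2 : srcWindowWt M ⟨(k 0).val, ZMod.val_lt (k 0)⟩ = 0 := by
      refine srcWindowWt_eq_zero hM ?_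
      rw [matsubaraInt_cast_real]; dsimp only
      have h1M : (1 : ℝ) ≤ M := by exact_mod_cast hM
      have hv : ((k 0).val : ℝ) = 2 * M - 1 := by
        have : ((k 0).val : ℝ) + 1 = 2 * M := by exact_mod_cast hwrap
        linarith
      rw [hv, show (2 : ℝ) * (2 * M - 1 - M) + 1 = 2 * M - 1 by ring, abs_of_nonneg (by linarith)]
      linarith
    rw [hw1, hw2, sub_zero, abs_zero]
    positivity
  · have hlt : (k 0).val + 1 < 2 * M := lt_of_le_of_ne (ZMod.val_lt (k 0)) hwrap
    have h1 : ((k + fun _ : Fin 1 => (1 : ZMod (2 * M))) 0).val = (k 0).val + 1 := by rw [hval, Nat.mod_eq_of_lt hlt]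
    refine (abs_srcWindowWt_sub_le hM hc _ _).trans ?_
    rw [matsubaraInt_cast_real, matsubaraInt_cast_real]
    dsimp only
    rw [h1]; push_cast
    rw [show ((2 : ℝ) * (((k 0).val : ℝ) + 1 - M) + 1) / M - (2 * (((k 0).val : ℝ) - M) + 1) / M = 2 / M by field_simp; ring,
      abs_of_pos (by positivity)]
    rw [show c₁ * (4 / ((2 : ℝ) * M)) = c₁ * (2 / M) by field_simp; ring]

/-! ### The kernel as a character sum -/

omit [NeZero M] [NeZero (2 * M)] in
/-- The natural representative `v_c(τ,τ′) ∈ [0, 4M)` with `v ≡ −s_c·(τ − τ′) (mod 2M)` and `v + s_c(τ − τ′) = 2M`. -/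
theorem srcShift_spec (c : Fin 2) (τ τ' : ImagTimeIdx M) :
    ((if c = 0 then (τ' : ℕ) + 2 * M - (τ : ℕ) else (τ : ℕ) + 2 * M - (τ' : ℕ) : ℕ) : ℝ) +
        chargeSign c * (((τ : ℕ) : ℝ) - ((τ' : ℕ) : ℝ)) = 2 * M := by
  have hτ := τ.2; have hτ' := τ'.2
  unfold chargeSign
  split_ifs with hc
  · have h : (τ : ℕ) ≤ (τ' : ℕ) + 2 * M := by omega
    rw [Nat.cast_sub h]; push_cast; ring
  · have h : (τ' : ℕ) ≤ (τ : ℕ) + 2 * M := by omega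
    rw [Nat.cast_sub h]; push_cast; ring

omit [NeZero (2 * M)] in
/-- **Each phase of the kernel is a `j`-independent unimodular factor times the `j`-th power of `exp(2πi v/(2M))`.** -/
theorem exp_srcSmoothPhase_eq (c : Fin 2) (τ τ' : ImagTimeIdx M) (j : MatsubaraIdx M) :
    Complex.exp (-((chargeSign c * srcSmoothPhase M j τ τ' : ℝ) : ℂ) * Complex.I) =
      Complex.exp (2 * π * Complex.I * ((if c = 0 then (τ' : ℕ) + 2 * M - (τ : ℕ) else (τ : ℕ) + 2 * M - (τ' : ℕ) : ℕ) : ℂ) / ((2 * M : ℕ) : ℂ)) ^ (j : ℕ) *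
        Complex.exp (-((chargeSign c * (π * (1 - 2 * M) * ((((τ : ℕ) : ℝ) - ((τ' : ℕ) : ℝ)) / (2 * M))) : ℝ) : ℂ) * Complex.I) := by
  have hM : (0 : ℝ) < M := by exact_mod_cast Nat.pos_of_ne_zero (NeZero.ne M)
  set v : ℕ := (if c = 0 then (τ' : ℕ) + 2 * M - (τ : ℕ) else (τ : ℕ) + 2 * M - (τ' : ℕ) : ℕ) with hv
  have hvspec := srcShift_spec (M := M) c τ τ'
  rw [← hv] at hvspec
  rw [← Complex.exp_nat_mul, ← Complex.exp_add]
  -- the exponents differ by `−j·(2πi)`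
  have hkey : -((chargeSign c * srcSmoothPhase M j τ τ' : ℝ) : ℂ) * Complex.I =
      ((j : ℕ) : ℂ) * (2 * π * Complex.I * (v : ℂ) / ((2 * M : ℕ) : ℂ)) +
        -((chargeSign c * (π * (1 - 2 * M) * ((((τ : ℕ) : ℝ) - ((τ' : ℕ) : ℝ)) / (2 * M))) : ℝ) : ℂ) * Complex.I +
        (-((j : ℕ) : ℤ) : ℂ) * (2 * π * Complex.I) := by
    unfold srcSmoothPhase
    rw [matsubaraInt_cast_real]
    have hvC : (v : ℂ) = ((v : ℝ) : ℂ) := by norm_cast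
    have hvR : (v : ℝ) = 2 * M - chargeSign c * (((τ : ℕ) : ℝ) - ((τ' : ℕ) : ℝ)) := by linarith
    rw [hvC, hvR]
    have hM2 : ((2 * M : ℕ) : ℂ) = 2 * (M : ℂ) := by push_cast; ring
    rw [hM2]
    have hMC : (M : ℂ) ≠ 0 := by exact_mod_cast (NeZero.ne M)
    push_cast
    field_simp
    ring
  rw [hkey, Complex.exp_add]
  have h1 : Complex.exp ((-((j : ℕ) : ℤ) : ℂ) * (2 * π * Complex.I)) = 1 := by
    have := Complex.exp_int_mul_two_pi_mul_I (-((j : ℕ) : ℤ))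
    exact_mod_cast this
  rw [h1, mul_one]

/-- **The kernel's norm is `(1/2M)` times the norm of a character sum on `(ℤ/2M)¹` with the window as symbol.** -/
theorem norm_srcSmoothKernel_eq_charSum (c : Fin 2) (τ τ' : ImagTimeIdx M) :
    ‖srcSmoothKernel M c τ τ'‖ = 1 / (2 * (M : ℝ)) *
      ‖∑ k : TorusSite 1 (2 * M),
        torusChar k (fun _ : Fin 1 => (((if c = 0 then (τ' : ℕ) + 2 * M - (τ : ℕ) else (τ : ℕ) + 2 * M - (τ' : ℕ) : ℕ) : ℕ) : ZMod (2 * M))) *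
          (((srcWindowWt M ⟨(k 0).val, ZMod.val_lt (k 0)⟩ : ℝ)) : ℂ)‖ := by
  have hM : (0 : ℝ) < M := by exact_mod_cast Nat.pos_of_ne_zero (NeZero.ne M)
  set v : ℕ := (if c = 0 then (τ' : ℕ) + 2 * M - (τ : ℕ) else (τ : ℕ) + 2 * M - (τ' : ℕ) : ℕ) with hv
  unfold srcSmoothKernel
  simp_rw [exp_srcSmoothPhase_eq, ← hv]
  -- pull the unimodular `j`-independent factor out of the sum
  set u : ℂ := Complex.exp (-((chargeSign c * (π * (1 - 2 * M) * ((((τ : ℕ) : ℝ) - ((τ' : ℕ) : ℝ)) / (2 * M))) : ℝ) : ℂ) * Complex.I) with hu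
  have hu1 : ‖u‖ = 1 := by rw [hu, ← Complex.ofReal_neg, Complex.norm_exp_ofReal_mul_I]
  have hsum : ∑ j : MatsubaraIdx M, ((srcWindowWt M j : ℝ) : ℂ) * (Complex.exp (2 * π * Complex.I * (v : ℂ) / ((2 * M : ℕ) : ℂ)) ^ (j : ℕ) * u) =
      u * ∑ k : TorusSite 1 (2 * M), torusChar k (fun _ : Fin 1 => ((v : ℕ) : ZMod (2 * M))) *
        (((srcWindowWt M ⟨(k 0).val, ZMod.val_lt (k 0)⟩ : ℝ)) : ℂ) := by
    rw [mul_sum]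
    -- re-index `j ↦ k := fun _ => (j : ZMod 2M)`
    refine Fintype.sum_equiv ⟨fun j : MatsubaraIdx M => fun _ : Fin 1 => ((j : ℕ) : ZMod (2 * M)),
      fun k => ⟨(k 0).val, ZMod.val_lt (k 0)⟩, fun j => ?_, fun k => ?_⟩ _ _ fun j => ?_
    · apply Fin.ext
      simp only [ZMod.val_natCast, Nat.mod_eq_of_lt j.2]
    · funext i
      rw [Subsingleton.elim i 0]
      simp only [ZMod.natCast_val, ZMod.cast_id', id_eq]
    · simp only [Equiv.coe_fn_mk]
      rw [torusChar_natCast_one (2 * M) (j : ℕ) v]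
      have hj : (⟨((fun _ : Fin 1 => ((j : ℕ) : ZMod (2 * M))) 0).val, ZMod.val_lt _⟩ : MatsubaraIdx M) = j := by
        apply Fin.ext
        simp only [ZMod.val_natCast, Nat.mod_eq_of_lt j.2]
      rw [hj]
      push_cast
      ring
  rw [hsum, norm_mul, norm_mul, hu1, one_mul, Complex.norm_real, Real.norm_eq_abs, abs_of_pos (by positivity)]

/-! ### Rows and columns -/

/-- **The `ℓ¹` ROWS of the smoothing kernel are `M`-uniform**: `Σ_{τ′} ‖W_c(τ,τ′)‖ ≤ (1/2M)·√(2+π)·√(2M·(2M·1² + 2M·c₁²))` (`= √(2+π)·√(1+c₁²)`,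
`c₁` the Lipschitz constant of `χ` on `[−2,2]` supplied as `hc`).
[cite: BenfattoGiulianiMastropietro2006, Lemma 2.2 and footnote 1] -/
theorem sum_norm_srcSmoothKernel_row_le {c₁ : ℝ} (hc₀ : 0 ≤ c₁)
    (hc : ∀ x y : ℝ, x ∈ Set.Icc (-2 : ℝ) 2 → y ∈ Set.Icc (-2 : ℝ) 2 → |srcWindowFn y - srcWindowFn x| ≤ c₁ * |y - x|) (c : Fin 2) (τ : ImagTimeIdx M) :
    ∑ τ' : ImagTimeIdx M, ‖srcSmoothKernel M c τ τ'‖ ≤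
      1 / (2 * (M : ℝ)) * (Real.sqrt (2 + Real.pi) * Real.sqrt (((2 * M : ℕ) : ℝ) * ((2 * M : ℕ) * (1 : ℝ) ^ 2 + (2 * M : ℕ) * c₁ ^ 2))) := by
  classical
  have hM : (0 : ℝ) < M := by exact_mod_cast Nat.pos_of_ne_zero (NeZero.ne M)
  set h : TorusSite 1 (2 * M) → ℂ := fun k => (((srcWindowWt M ⟨(k 0).val, ZMod.val_lt (k 0)⟩ : ℝ)) : ℂ) with hh
  set φ : ImagTimeIdx M → TorusSite 1 (2 * M) := fun τ' => fun _ : Fin 1 =>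
    (((if c = 0 then (τ' : ℕ) + 2 * M - (τ : ℕ) else (τ : ℕ) + 2 * M - (τ' : ℕ) : ℕ) : ℕ) : ZMod (2 * M)) with hφ
  have hterm : ∀ τ', ‖srcSmoothKernel M c τ τ'‖ = 1 / (2 * (M : ℝ)) * ‖∑ k, torusChar k (φ τ') * h k‖ := fun τ' =>
    norm_srcSmoothKernel_eq_charSum c τ τ'
  simp_rw [hterm, ← mul_sum]
  refine mul_le_mul_of_nonneg_left ?_ (by positivity)
  -- `φ` is injective: re-index and compare with the full sum
  have hcast : ∀ τ₁ : ImagTimeIdx M, (φ τ₁) 0 =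
      if c = 0 then ((τ₁ : ℕ) : ZMod (2 * M)) - ((τ : ℕ) : ZMod (2 * M)) else ((τ : ℕ) : ZMod (2 * M)) - ((τ₁ : ℕ) : ZMod (2 * M)) := by
    intro τ₁
    have hτ₁ := τ₁.2; have hτ := τ.2
    have hself : ((2 * M : ℕ) : ZMod (2 * M)) = 0 := ZMod.natCast_self _
    simp only [hφ]
    split_ifs with hc
    · rw [Nat.cast_sub (by omega : (τ : ℕ) ≤ (τ₁ : ℕ) + 2 * M), Nat.cast_add, hself, add_zero]
    · rw [Nat.cast_sub (by omega : (τ₁ : ℕ) ≤ (τ : ℕ) + 2 * M), Nat.cast_add, hself, add_zero]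
  have hinj : Function.Injective φ := by
    intro τ₁ τ₂ h12
    have h0 := congr_fun h12 0
    rw [hcast, hcast] at h0
    have hc12 : ((τ₁ : ℕ) : ZMod (2 * M)) = ((τ₂ : ℕ) : ZMod (2 * M)) := by
      split_ifs at h0
      · exact sub_left_injective h0
      · exact sub_right_injective h0
    rw [ZMod.natCast_eq_natCast_iff', Nat.mod_eq_of_lt τ₁.2, Nat.mod_eq_of_lt τ₂.2] at hc12
    exact Fin.ext hc12
  calc ∑ τ', ‖∑ k, torusChar k (φ τ') * h k‖ = ∑ x ∈ univ.image φ, ‖∑ k, torusChar k x * h k‖ := by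
        rw [sum_image fun a _ b _ hab => hinj hab]
    _ ≤ ∑ x, ‖∑ k, torusChar k x * h k‖ :=
        sum_le_sum_of_subset_of_nonneg (subset_univ _) fun x _ _ => norm_nonneg _
    _ ≤ _ := sum_norm_charSum_one_le_of_bounds h (A := 1) (D := c₁) (Ns := 2 * M) (Nd := 2 * M)
        ((card_filter_le _ _).trans (by simp)) (fun k => srcWindowSymbol_norm_le k)
        ((card_filter_le _ _).trans (by simp)) (fun k => norm_fwdDiff_srcWindowSymbol_le hc₀ hc k)

omit [NeZero M] [NeZero (2 * M)] in
/-- The kernel is Hermitian-symmetric in norm: `‖W_c(τ,τ′)‖ = ‖W_c(τ′,τ)‖` (complex conjugation of the phases; the window is real). -/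
theorem norm_srcSmoothKernel_symm (c : Fin 2) (τ τ' : ImagTimeIdx M) : ‖srcSmoothKernel M c τ τ'‖ = ‖srcSmoothKernel M c τ' τ‖ := by
  have hφ : ∀ j : MatsubaraIdx M, srcSmoothPhase M j τ' τ = -srcSmoothPhase M j τ τ' := fun j => by unfold srcSmoothPhase; ring
  have hS : ∑ j : MatsubaraIdx M, ((srcWindowWt M j : ℝ) : ℂ) * Complex.exp (-((chargeSign c * srcSmoothPhase M j τ' τ : ℝ) : ℂ) * Complex.I) =
      (starRingEnd ℂ) (∑ j : MatsubaraIdx M, ((srcWindowWt M j : ℝ) : ℂ) * Complex.exp (-((chargeSign c * srcSmoothPhase M j τ τ' : ℝ) : ℂ) * Complex.I)) := by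
    rw [map_sum]
    refine sum_congr rfl fun j _ => ?_
    rw [map_mul, Complex.conj_ofReal, ← Complex.exp_conj, hφ]
    congr 1
    simp only [map_mul, map_neg, Complex.conj_ofReal, Complex.conj_I]
    push_cast
    ring
  unfold srcSmoothKernel
  rw [hS, norm_mul, norm_mul, Complex.norm_conj]

/-- **The `ℓ¹` COLUMNS of the smoothing kernel are `M`-uniform** (by the symmetry of the norms). -/
theorem sum_norm_srcSmoothKernel_col_le {c₁ : ℝ} (hc₀ : 0 ≤ c₁)
    (hc : ∀ x y : ℝ, x ∈ Set.Icc (-2 : ℝ) 2 → y ∈ Set.Icc (-2 : ℝ) 2 → |srcWindowFn y - srcWindowFn x| ≤ c₁ * |y - x|) (c : Fin 2) (τ' : ImagTimeIdx M) :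
    ∑ τ : ImagTimeIdx M, ‖srcSmoothKernel M c τ τ'‖ ≤
      1 / (2 * (M : ℝ)) * (Real.sqrt (2 + Real.pi) * Real.sqrt (((2 * M : ℕ) : ℝ) * ((2 * M : ℕ) * (1 : ℝ) ^ 2 + (2 * M : ℕ) * c₁ ^ 2))) := by
  simp_rw [norm_srcSmoothKernel_symm c _ τ']
  exact sum_norm_srcSmoothKernel_row_le hc₀ hc c τ'

/-- The `M`-free form of the row bound: `Σ_{τ′} ‖W_c(τ,τ′)‖ ≤ √(2+π)·√(1+c₁²)`. [folklore] -/
theorem sum_norm_srcSmoothKernel_row_le' {c₁ : ℝ} (hc₀ : 0 ≤ c₁)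
    (hc : ∀ x y : ℝ, x ∈ Set.Icc (-2 : ℝ) 2 → y ∈ Set.Icc (-2 : ℝ) 2 → |srcWindowFn y - srcWindowFn x| ≤ c₁ * |y - x|) (c : Fin 2) (τ : ImagTimeIdx M) :
    ∑ τ' : ImagTimeIdx M, ‖srcSmoothKernel M c τ τ'‖ ≤ Real.sqrt (2 + Real.pi) * Real.sqrt (1 + c₁ ^ 2) := by
  have hM : (0 : ℝ) < M := by exact_mod_cast Nat.pos_of_ne_zero (NeZero.ne M)
  refine (sum_norm_srcSmoothKernel_row_le hc₀ hc c τ).trans (le_of_eq ?_)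
  have h2M : (0 : ℝ) ≤ ((2 * M : ℕ) : ℝ) := by positivity
  have hinner : ((2 * M : ℕ) : ℝ) * ((2 * M : ℕ) * (1 : ℝ) ^ 2 + (2 * M : ℕ) * c₁ ^ 2) = (((2 * M : ℕ) : ℝ)) ^ 2 * (1 + c₁ ^ 2) := by ring
  rw [hinner, Real.sqrt_mul (sq_nonneg _), Real.sqrt_sq h2M]
  push_cast
  field_simp

/-- The `M`-free form of the column bound. [folklore] -/
theorem sum_norm_srcSmoothKernel_col_le' {c₁ : ℝ} (hc₀ : 0 ≤ c₁)
    (hc : ∀ x y : ℝ, x ∈ Set.Icc (-2 : ℝ) 2 → y ∈ Set.Icc (-2 : ℝ) 2 → |srcWindowFn y - srcWindowFn x| ≤ c₁ * |y - x|) (c : Fin 2) (τ' : ImagTimeIdx M) :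
    ∑ τ : ImagTimeIdx M, ‖srcSmoothKernel M c τ τ'‖ ≤ Real.sqrt (2 + Real.pi) * Real.sqrt (1 + c₁ ^ 2) := by
  simp_rw [norm_srcSmoothKernel_symm c _ τ']
  exact sum_norm_srcSmoothKernel_row_le' hc₀ hc c τ'

/-- **AN ABSOLUTE `ℓ¹` CONSTANT OF THE SMOOTHING** (both rows and columns, every `M ≥ 1`, every charge). [folklore] -/
theorem exists_srcSmoothKernel_l1_bound :
    ∃ Cw : ℝ, 0 ≤ Cw ∧ (∀ (M : ℕ) (c : Fin 2) (τ : ImagTimeIdx M), ∑ τ' : ImagTimeIdx M, ‖srcSmoothKernel M c τ τ'‖ ≤ Cw) ∧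
      (∀ (M : ℕ) (c : Fin 2) (τ' : ImagTimeIdx M), ∑ τ : ImagTimeIdx M, ‖srcSmoothKernel M c τ τ'‖ ≤ Cw) := by
  obtain ⟨c₁, hc₀, hc⟩ := exists_srcWindowFn_lipschitz
  refine ⟨Real.sqrt (2 + Real.pi) * Real.sqrt (1 + c₁ ^ 2), by positivity, fun M c τ => ?_, fun M c τ' => ?_⟩
  · rcases Nat.eq_zero_or_pos M with hM | hM
    · subst hM; exact absurd τ.2 (by omega)
    · haveI : NeZero M := ⟨hM.ne'⟩
      haveI : NeZero (2 * M) := ⟨by omega⟩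
      exact sum_norm_srcSmoothKernel_row_le' hc₀ hc c τ
  · rcases Nat.eq_zero_or_pos M with hM | hM
    · subst hM; exact absurd τ'.2 (by omega)
    · haveI : NeZero M := ⟨hM.ne'⟩
      haveI : NeZero (2 * M) := ⟨by omega⟩
      exact sum_norm_srcSmoothKernel_col_le' hc₀ hc c τ'

end Kernel

end Summit.HubbardSuperconductivity.HubbardSuperconductivity.Theorems.TwoVolumeSource

end
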